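import Summits.HodgeConjecture.HodgeConjecture.Theorems.GenericDivisibilityBounded.Negative.LoadBearing
import Literature.AlgebraicGeometry.HodgeTheory.WeilClassesSurfacesProofs
import Literature.AlgebraicGeometry.HodgeTheory.SupportedClassesHodgeConiveauHolds
import Literature.AlgebraicGeometry.HodgeTheory.SupportedClassesHodgeConiveauOfDeligne
import Literature.AlgebraicGeometry.HodgeTheory.SupportedClassesRationalProofs
import Literature.AlgebraicGeometry.HodgeTheory.RationalLatticeIntegral
import Literature.AlgebraicGeometry.HodgeTheory.IntegralClassesCountable
import Literature.NumberTheory.Transcendental.AnalytificationProjProofs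

/-!
# `GenericDivisibilityBounded` (C2, stmt-HodgeConjecture-18467) · Negative · a class of coniveau `0`,
# and three load-bearing hypotheses made UNCONDITIONAL

Standing disprover, cdisprove gen-2 (refuter-cdisprove-stmt-HodgeConjecture-18467-g2-0, 2026-08-17).
Companion of `Negative/LoadBearing.lean` (gen-1), whose `_false_without_allModuli` was conditional on
`ExistsMiddleClassOfConiveauZero` ("some smooth projective `2p`-fold carries an integral middle class
whose complexification is NOT of coniveau `≥ 1`"), then believed not constructible on the tree's
carriers. It IS constructible now, with `p = 1`, on the abelian surface `E_τ × E_τ`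
(`WeilSquare.square`, analytified by the torus `ℂ²/(ℤ + τℤ)²`): the invariant holomorphic `2`-form
`du₀ ∧ du₁` gives a NON-ZERO class of Hodge type `(2,0)` (Lange–Birkenhake Prop. 1.1.20/Thm. 1.1.21 (a):
`ComplexTorus.cconstClassEquiv`, `cconstClass_mem_hodgePQ`), while on any smooth projective `X` with
`N¹Hᵏ(X(ℂ); ℂ) = Hᵏ` every `(k,0)`-class vanishes (Grothendieck 1969 (∗) / Deligne 8.2.8, the tree's
PROVED `Grothendieck1969_supportedClasses_le_hodgeConiveau_holds`); integral classes span `H²(X(ℂ); ℂ)`,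
so one of them has complexification outside `N¹H²`.

Consequences (all sorry-free, no named fact assumed):
* `existsMiddleClassOfConiveauZero` — gen-1's hypothesis `H`, discharged;
* `not_genericDivisibilityBoundedSingleModulus` — **`∀ m` is load-bearing, unconditionally**: for every
  single modulus `m ≥ 1` the one-modulus form of C2 is FALSE (`z = m • z₀`, `Z = ∅`);
* `genericDivisibilityBounded_false_without_neUniv` — **`Z ≠ univ` is load-bearing**: with the empty
  open allowed (`Z = X`, `(X ∖ X)(ℂ) = ∅`, cohomology `0`) every class is "divisible", and `z₀` is not
  of coniveau `≥ 1`;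
* `genericDivisibilityBounded_false_without_isClosed` — **`IsClosed Z` is load-bearing**: the
  non-closed `Z = X ∖ {η}` (`η` the generic point) is `≠ univ` yet NO complex point lies over `η`
  (complex points are closed points, `ComplexPoints.isClosed_pt`; `E × E` has two of them), so again
  `(X ∖ Z)(ℂ) = ∅`.
So every syntactic constituent of the hypothesis of C2 is now certified load-bearing except `1 ≤ p`
(not load-bearing: `p = 0` is true, gen-1) and `1 ≤ m` (dropping it STRENGTHENS the hypothesis:
`0 • y = z|` forces `z| = 0`).

References: [LangeBirkenhake1992] §1.1.4 Prop. 1.1.20, §1.1.5 Thm. 1.1.21; [GrothendieckTopology1969]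
p. 299 (∗), p. 300; [DeligneHodgeIII1974] Cor. 8.2.8; [VoisinHodgeI2002] §7.1.1, §11.3; [HatcherAT2002] §3.1.
-/

noncomputable section

-- The mandated namespace `Summit.<P>.<Sub>.Theorems.…` repeats `HodgeConjecture` (single-conjunct summit).
set_option linter.dupNamespace false

open CategoryTheory AlgebraicGeometry

namespace Summit.HodgeConjecture.HodgeConjecture.Theorems.GenericDivisibilityBounded.Negative.ConiveauZeroWitness

open Literature.AlgebraicGeometry.Motives Literature.AlgebraicGeometry.HodgeTheory
  Literature.AlgebraicTopology.SingularHomology Literature.Geometry.Kaehler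
  Literature.NumberTheory.Transcendental
open Summit.HodgeConjecture.HodgeConjecture.Theorems.GenericDivisibilityBounded.Negative.LoadBearing
open WeilSquare

/-! ### The holomorphic `2`-form `du₀ ∧ du₁` on `ℂ²` and its class on `E_τ × E_τ` -/

section Surface

variable (τ : ℂ) (hτ : τ.im ≠ 0)

/-- `du₀ ∧ d(u₀ + u₁) = du₀ ∧ du₁`, written with the tree's `WeilSquare.linForm`: its value on a pair
of vectors. [cite: LangeBirkenhake1992, §1.1.5] -/
theorem holTwoForm_apply (v : Fin 2 → (Fin 2 → ℂ)) :
    (dOne (linForm 0)).wedge (dOne (linForm 1)) v =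
      (v 0 0 + 0 * v 0 1) * (v 1 0 + 1 * v 1 1) - (v 1 0 + 0 * v 1 1) * (v 0 0 + 1 * v 0 1) := by
  rw [ContinuousAlternatingMap.wedge_apply_one_one]
  simp only [dOne_apply, linForm_apply]
  rfl

/-- `du₀ ∧ du₁ ≠ 0` (it is `1` on `(e₀, e₁)`). [folklore] -/
theorem holTwoForm_ne_zero : (dOne (linForm 0)).wedge (dOne (linForm 1)) ≠ 0 := by
  intro h
  have h1 := congrArg (fun ω : (Fin 2 → ℂ) [⋀^Fin 2]→L[ℝ] ℂ ↦ ω ![Pi.single 0 1, Pi.single 1 1]) h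
  simp only [holTwoForm_apply, ContinuousAlternatingMap.coe_zero, Pi.zero_apply] at h1
  simp at h1

/-- `du₀ ∧ du₁` is an invariant form of type `(2, 0)`: weight `2` under `v ↦ e^{iθ} v`.
[cite: LangeBirkenhake1992, §1.1.5] -/
theorem isConstOfType_holTwoForm :
    ComplexTorus.IsConstOfType (k := 2) 2 0 ((dOne (linForm 0)).wedge (dOne (linForm 1))) := by
  refine ⟨rfl, fun θ v ↦ ?_⟩
  rw [holTwoForm_apply, holTwoForm_apply]
  simp only [Pi.smul_apply, smul_eq_mul]
  have h2 : Complex.exp ((((2 : ℕ) : ℤ) - (0 : ℕ) : ℤ) * θ * Complex.I) =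
      Complex.exp (θ * Complex.I) * Complex.exp (θ * Complex.I) := by
    rw [← Complex.exp_add]
    congr 1
    push_cast
    ring
  rw [h2]
  ring

/-- **`E_τ × E_τ` carries a non-zero class of Hodge type `(2, 0)`** (the class of `du₀ ∧ du₁` in the
torus model `WeilSquare.hodgeModel`: invariant forms inject into de Rham cohomology,
Lange–Birkenhake Prop. 1.1.20, and forms of type `(p,q)` give classes in `H^{p,q}`, Thm. 1.1.21 (a)).
[cite: LangeBirkenhake1992, Prop. 1.1.20 and Thm. 1.1.21] -/
theorem exists_ne_zero_isOfHodgeType_two_zero :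
    ∃ c : complexBetti (square τ hτ).X 2, c ≠ 0 ∧ IsOfHodgeType 2 (square τ hτ).X 2 2 0 c := by
  obtain ⟨e, he⟩ := exists_complexDeRhamIsoFamily_holds (Fin 2 → ℂ)
  set ω : (Fin 2 → ℂ) [⋀^Fin 2]→L[ℝ] ℂ := (dOne (linForm 0)).wedge (dOne (linForm 1)) with hω
  set s := deRhamIso τ hτ e (ComplexTorus.cconstClass (periodIso τ hτ) ω) with hs
  refine ⟨pullbackInv τ hτ s, ?_, ?_⟩
  · intro h0
    have h1 : s = 0 := pullbackInv_injective τ hτ (by rw [h0, map_zero])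
    have h2 : ComplexTorus.cconstClass (periodIso τ hτ) (k := 2) ω = 0 :=
      (deRhamIso τ hτ e).injective (by rw [← hs, h1, map_zero])
    have h3 : ω = 0 := (ComplexTorus.cconstClassEquiv (periodIso τ hτ) (k := 2)).injective
      (by rw [ComplexTorus.cconstClassEquiv_apply, ComplexTorus.cconstClassEquiv_apply, h2, map_zero])
    exact holTwoForm_ne_zero (hω ▸ h3)
  · refine ⟨hodgeModel τ hτ e he, ?_⟩
    rw [hodgeModel_pullback, pullbackHom_pullbackInv]
    change s ∈ (hodgePQ (Fin 2 → ℂ) (Torus τ hτ) 2 2 0).map (deRhamIso τ hτ e).toLinearMap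
    exact Submodule.mem_map_of_mem
      (ComplexTorus.cconstClass_mem_hodgePQ (periodIso τ hτ) (isConstOfType_holTwoForm))

/-- **`N¹H²((E_τ × E_τ)(ℂ); ℂ) ≠ H²`**: on a smooth projective `X` with `N¹Hᵏ = Hᵏ` every class of type
`(k, 0)` vanishes (Grothendieck 1969 (∗), proved in the tree from Deligne 8.2.8), but `du₀ ∧ du₁ ≠ 0`.
[cite: GrothendieckTopology1969, p. 299 (∗) and p. 300] [cite: DeligneHodgeIII1974, Cor. 8.2.8] -/
theorem supportedClasses_square_two_one_ne_top : supportedClasses (square τ hτ).X 2 1 ≠ ⊤ := by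
  intro htop
  obtain ⟨c, hc0, hc⟩ := exists_ne_zero_isOfHodgeType_two_zero τ hτ
  exact hc0 (forall_isOfHodgeType_zero_eq_zero_of_supportedClasses_eq_top
    Grothendieck1969_supportedClasses_le_hodgeConiveau_holds (isSmoothProjective_square τ hτ) htop c hc)

/-- **Some INTEGRAL class `z ∈ H²((E_τ × E_τ)(ℂ); ℤ)` has complexification outside `N¹H²`**: the
rational classes span `H²(X(ℂ); ℂ)` (universal coefficients on the compact manifold `X(ℂ)`), each is
`N⁻¹ • (z ⊗ 1)` for an integral `z`, and `N¹` is a proper `ℂ`-submodule. [cite: HatcherAT2002, §3.1 Thm. 3.2]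
[cite: VoisinHodgeI2002, §7.1.1] -/
theorem exists_ringChange_not_mem_supportedClasses :
    ∃ z : singularCohomology ℤ ℤ (ComplexPoints (square τ hτ).X) 2,
      singularCohomology.ringChange (Int.castRingHom ℂ) (ComplexPoints (square τ hτ).X) 2 z ∉
        supportedClasses (square τ hτ).X 2 1 := by
  by_contra h
  push Not at h
  apply supportedClasses_square_two_one_ne_top τ hτ
  rw [eq_top_iff, ← span_isRationalClass_eq_top_of_isSmoothProjective_holds 2 (square τ hτ).X
    (isSmoothProjective_square τ hτ) 2, Submodule.span_le]
  intro c hc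
  obtain ⟨N, hN, hNc⟩ :=
    IsRationalClass.exists_nsmul_isIntegralClass (isSmoothProjective_square τ hτ) hc
  obtain ⟨z, hz⟩ := (isIntegralClass_iff_mem_range_ringChange _).1 hNc
  have hmem := h z
  rw [hz] at hmem
  have hN' : (N : ℂ) ≠ 0 := Nat.cast_ne_zero.2 hN.ne'
  have h' : (N : ℂ)⁻¹ • ((N : ℂ) • c) ∈ supportedClasses (square τ hτ).X 2 1 :=
    Submodule.smul_mem _ _ hmem
  rwa [smul_smul, inv_mul_cancel₀ hN', one_smul] at h'

/-- `1/2 ∉ ℤ + τℤ` (`Im τ ≠ 0`). [folklore] -/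
theorem one_half_not_mem_lattice : (1 / 2 : ℂ) ∉ (periodPair τ hτ).lattice := by
  rw [mem_lattice_periodPair_iff]
  rintro ⟨m, n, h⟩
  have him := congrArg Complex.im h
  simp only [Complex.add_im, Complex.intCast_im, Complex.mul_im, Complex.intCast_re, zero_mul,
    add_zero, zero_add, Complex.div_ofNat_im, Complex.one_im, zero_div] at him
  have hn : n = 0 := by exact_mod_cast (mul_eq_zero.mp him).resolve_right hτ
  have hre := congrArg Complex.re h
  rw [hn] at hre
  simp only [Int.cast_zero, zero_mul, add_zero, Complex.intCast_re, Complex.div_ofNat_re,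
    Complex.one_re] at hre
  have h2 : (2 * m : ℤ) = 1 := by exact_mod_cast (by linarith : (2 * (m : ℝ)) = 1)
  omega

/-- **No complex point of `E_τ × E_τ` lies over the generic point**: complex points are closed points
(`ComplexPoints.isClosed_pt`), a closed generic point would make the underlying space a single point,
and `E_τ × E_τ` has two distinct complex points (`sqMap 0 ≠ sqMap (1/2, 0)`), which over a locally
finite-type scheme are distinguished by their points (`ComplexPoints.ext_of_pt_eq`). [folklore] -/
theorem pt_ne_genericPoint (P : ComplexPoints (square τ hτ).X) :
    P.pt ≠ genericPoint (square τ hτ).X.left := by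
  have hX := isSmoothProjective_square τ hτ
  haveI := hX.geometricallyIrreducible
  haveI : IrreducibleSpace (square τ hτ).X.left :=
    GeometricallyIrreducible.irreducibleSpace_of_subsingleton (square τ hτ).X.hom
  haveI := hX.smoothOfRelativeDimension
  haveI : Smooth (square τ hτ).X.hom := SmoothOfRelativeDimension.smooth 2 _
  haveI : LocallyOfFiniteType (square τ hτ).X.hom := inferInstance
  intro h
  have hcl := ComplexPoints.isClosed_pt P
  have hall : ∀ y : (square τ hτ).X.left, y = P.pt := fun y ↦ by
    have hy : y ∈ closure {genericPoint (square τ hτ).X.left} := by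
      rw [(genericPoint_spec _).def]; trivial
    rw [← h, hcl.closure_eq] at hy
    exact hy
  -- two distinct complex points
  have hne : sqMap τ hτ 0 ≠ sqMap τ hτ ![1 / 2, 0] := by
    intro heq
    have h0 := (sqMap_eq_sqMap_iff τ hτ).1 heq 0
    simp only [Pi.zero_apply, Matrix.cons_val_zero, zero_sub, neg_mem_iff] at h0
    exact one_half_not_mem_lattice τ hτ h0
  exact hne (ComplexPoints.ext_of_pt_eq ((hall _).trans (hall _).symm))

end Surface

/-! ### The discharge, and three unconditional load-bearing lemmas -/

/-- **`H_coniv0` holds: DISCHARGE of gen-1's hypothesis `ExistsMiddleClassOfConiveauZero`** — with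
`p = 1`, `X = E_i × E_i`. [cite: GrothendieckTopology1969, p. 300] [cite: LangeBirkenhake1992, Thm. 1.1.21] -/
theorem existsMiddleClassOfConiveauZero : ExistsMiddleClassOfConiveauZero := by
  obtain ⟨z, hz⟩ := exists_ringChange_not_mem_supportedClasses Complex.I (by simp)
  exact ⟨1, (square Complex.I (by simp)).X, z, le_rfl, isSmoothProjective_square _ _, hz⟩

/-- **`∀ m` is load-bearing, unconditionally**: for every single modulus `m ≥ 1` the one-modulus form
`GenericDivisibilityBoundedSingleModulus m` of C2 is FALSE (on `E_i × E_i`: `z = m • z₀` is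
`m`-divisible on all of `X(ℂ)`, `Z = ∅`, yet `z ⊗ 1 = m (z₀ ⊗ 1) ∉ N¹`). Any proof of C2 must use
infinitely many moduli. [cite: GrothendieckTopology1969, p. 300] -/
theorem not_genericDivisibilityBoundedSingleModulus {m : ℕ} (hm : 1 ≤ m) :
    ¬ GenericDivisibilityBoundedSingleModulus m :=
  genericDivisibilityBounded_false_without_allModuli existsMiddleClassOfConiveauZero hm

/-- **`Z ≠ univ` is load-bearing**: C2 with the non-emptiness of the open dropped from its hypothesis
is FALSE — `Z = X` is closed, `(X ∖ X)(ℂ) = ∅` has zero cohomology, so EVERY class is `m`-divisible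
there for every `m`, in particular the class `z₀` of coniveau `0` on `E_i × E_i`. [folklore] -/
theorem genericDivisibilityBounded_false_without_neUniv :
    ¬ (∀ ⦃p : ℕ⦄ ⦃X : SchemeOver ℂ⦄, 1 ≤ p → IsSmoothProjective (2 * p) X →
        ∀ z : singularCohomology ℤ ℤ (ComplexPoints X) (2 * p),
          (∀ m : ℕ, 1 ≤ m → ∃ Z : Set X.left, IsClosed Z ∧
            ∃ y : singularCohomology ℤ ℤ (complexPointsCompl X Z) (2 * p),
              m • y = singularCohomology.map ℤ ℤ
                (⟨Subtype.val, continuous_subtype_val⟩ : C(complexPointsCompl X Z, ComplexPoints X))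
                (2 * p) z) →
          singularCohomology.ringChange (Int.castRingHom ℂ) (ComplexPoints X) (2 * p) z ∈
            supportedClasses X (2 * p) 1) := by
  intro h
  obtain ⟨p, X, z, hp, hX, hz⟩ := existsMiddleClassOfConiveauZero
  refine hz (h hp hX z fun m _ ↦ ⟨Set.univ, isClosed_univ, ?_⟩)
  haveI : IsEmpty (complexPointsCompl X Set.univ) := ⟨fun P ↦ P.2 (Set.mem_univ _)⟩
  haveI := ModuleCat.subsingleton_of_isZero
    (isZero_singularCohomology_of_isEmpty ℤ ℤ (E := complexPointsCompl X Set.univ) (2 * p))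
  exact ⟨0, Subsingleton.elim _ _⟩

/-- **`IsClosed Z` is load-bearing**: C2 with the closedness of `Z` dropped (keeping `Z ≠ univ`) is
FALSE — on `X = E_i × E_i` take `Z = X ∖ {η}`, `η` the generic point: `Z ≠ univ`, but no complex point
lies over `η` (`pt_ne_genericPoint`), so `(X ∖ Z)(ℂ) = ∅` again and every class is divisible there,
including `z₀` of coniveau `0`. So "non-empty ZARISKI open" cannot be weakened to "complement of a
proper subset". [folklore] -/
theorem genericDivisibilityBounded_false_without_isClosed :
    ¬ (∀ ⦃p : ℕ⦄ ⦃X : SchemeOver ℂ⦄, 1 ≤ p → IsSmoothProjective (2 * p) X →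
        ∀ z : singularCohomology ℤ ℤ (ComplexPoints X) (2 * p),
          (∀ m : ℕ, 1 ≤ m → ∃ Z : Set X.left, Z ≠ Set.univ ∧
            ∃ y : singularCohomology ℤ ℤ (complexPointsCompl X Z) (2 * p),
              m • y = singularCohomology.map ℤ ℤ
                (⟨Subtype.val, continuous_subtype_val⟩ : C(complexPointsCompl X Z, ComplexPoints X))
                (2 * p) z) →
          singularCohomology.ringChange (Int.castRingHom ℂ) (ComplexPoints X) (2 * p) z ∈
            supportedClasses X (2 * p) 1) := by
  intro h
  have hI : Complex.I.im ≠ 0 := by simp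
  obtain ⟨z, hz⟩ := exists_ringChange_not_mem_supportedClasses Complex.I hI
  refine hz (h (p := 1) le_rfl (isSmoothProjective_square Complex.I hI) z fun m _ ↦
    ⟨{genericPoint (square Complex.I hI).X.left}ᶜ, ?_, ?_⟩)
  · intro hu
    have hmem : genericPoint (square Complex.I hI).X.left ∈
        ({genericPoint (square Complex.I hI).X.left}ᶜ : Set (square Complex.I hI).X.left) :=
      hu ▸ Set.mem_univ _
    exact hmem rfl
  · haveI : IsEmpty (complexPointsCompl (square Complex.I hI).X
        {genericPoint (square Complex.I hI).X.left}ᶜ) :=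
      ⟨fun P ↦ P.2 (fun hP ↦ pt_ne_genericPoint Complex.I hI P.1 hP)⟩
    haveI := ModuleCat.subsingleton_of_isZero
      (isZero_singularCohomology_of_isEmpty ℤ ℤ
        (E := complexPointsCompl (square Complex.I hI).X {genericPoint (square Complex.I hI).X.left}ᶜ)
        (2 * 1))
    exact ⟨0, Subsingleton.elim _ _⟩

end Summit.HodgeConjecture.HodgeConjecture.Theorems.GenericDivisibilityBounded.Negative.ConiveauZeroWitness

end
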